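import Literature.NumberTheory.Automorphic.QuadraticBaseChangeFrobCompatible
import Literature.NumberTheory.Automorphic.ReciprocityGLnRestrictionProofs
import Literature.NumberTheory.Automorphic.BaseChangeStrongAllFinite
import Literature.NumberTheory.Automorphic.AlgebraicityTwist
import Literature.NumberTheory.Automorphic.AutomorphicTwistNorm
import Literature.NumberTheory.Automorphic.ChebotarevArtinRepHolds
import Literature.NumberTheory.GaloisRepresentations.LAdicRepFrobenius
import Literature.NumberTheory.GaloisRepresentations.FramedRepEquivConj
import HarnessLib

/-!
# The almost-everywhere part of `Langlands1980_quadraticBaseChange_frobCompatible` (proved),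
# and the fact at every place above an unramified prime of `π` (given lang.S27 and strong lifting)

Topic `Literature/NumberTheory/Automorphic`; a *proofs* file (theorems only, no definition, no named
fact) next to `QuadraticBaseChangeFrobCompatible`, whose one named fact
`Langlands1980_quadraticBaseChange_frobCompatible` (Langlands 1980, §2 (A), (F) with the local lifting
(i) of principal series; Arthur–Clozel Ch. 3 Thm. 5.1; Carayol 1986 Thm. (A) and §12.2) asserts: for a
cuspidal `π` on `GL₂(𝔸_ℚ)`, an irreducible `ρ : Γ_ℚ → GL₂(ℚ̄_p)` Satake–Frobenius compatible with `π`
almost everywhere (L-normalisation `arithFrobPolyOfSatake ι q 1 α`), and a cuspidal weak base-change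
lift `P` of `π` to a quadratic field `F`, at **every** finite `w ∤ p` of `F` where `ρ|_{Γ_F}` is
unramified, `P` is unramified at `w` with a Satake parameter matching the Frobenius of `ρ|_{Γ_F}`.

## What is proved here

* `eventually_satakeFrobCompatible_restrictField_of_isWeakBaseChangeLiftAE` — the **almost
  everywhere** version, for every rank `n`, every extension of number fields `L/K`, every shift `m`
  of the Frobenius polynomial and arbitrary automorphic `π`, `P`: if `ρ` is Satake–Frobenius
  compatible with `π` at almost every place of `K` and `P` is a weak base-change lift of `π`
  (`IsWeakBaseChangeLiftAE`, Arthur–Clozel Ch. 3 (1.1): `t_{P,w} = t_{π,v}^{f(w|v)}` a.e.), then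
  `ρ|_{Γ_L}` is Satake–Frobenius compatible with `P` at almost every place of `L`.  This is the
  tree's bookkeeping (`eventually_under`: finitely many `w` over finitely many `v`;
  `hasFrobCharpolyAt_restrictField_arithFrobPolyOfSatake`: `Frob_w = Frob_v^{f(w|v)}` on an unramified
  `ρ`, `q_w = q_v^{f}`, and `arithFrobPolyOfSatake ι (q^f) m (α^f)` is the `f`-th power transform).
* `Langlands1980_quadraticBaseChange_frobCompatible_eventually` — the named fact's conclusion at
  **all but finitely many** `w`, under the named fact's hypotheses that are actually used (no
  cuspidality, infinity type, irreducibility or `w ∤ p` is needed for the a.e. statement).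

These show that the normalisations of the named fact (`m = 1`, `α ↦ α^{f(w|v)}`, arithmetic
Frobenius) are coherent at the good places.

* `hasFrobCharpolyAt_one_of_eventually_of_exists_galoisRep` — **from almost everywhere to every
  unramified place off `ℓ`**, general rank `n` over a totally real or CM field `K`, CONDITIONAL on
  the named fact lang.S27 `exists_galoisRep_of_regularAlgebraic` (Harris–Lan–Taylor–Thorne Thm. A
  with Varma's Thm. 1, compatibility at every unramified `v ∤ ℓ`): if `π` is cuspidal with a
  regular L-algebraic infinity type and the SEMISIMPLE `ρ : Γ_K → GL_n(ℚ̄_ℓ)` is Satake–Frobenius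
  compatible with `π` almost everywhere in the L-normalisation (`arithFrobPolyOfSatake ι q 1 α`),
  then `ρ` is compatible with `π` at EVERY finite `v ∤ ℓ` where `π` is unramified.  Proof: the
  twist `π ⊗ |det|^{(n-1)/2}` is regular algebraic (Buzzard–Gee §5.3, `AlgebraicityTwist`), its
  Satake parameters are `q_v^{-(n-1)/2} t_{π,v}` (`AutomorphicTwistNorm`), so the representation
  `r` of lang.S27 is compatible with `π` in the L-normalisation at every unramified `v ∤ ℓ`
  (`arithFrobPolyOfSatake_map_cpow_neg_half`); `ρ ≅ r` by Chebotarev and Brauer–Nesbitt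
  (`FramedGaloisRep.nonempty_equiv_of_hasFrobCharpolyAt_eventually`, with the PROVED
  `chebotarev_artinRep_holds`), and unramifiedness and Frobenius polynomials are isomorphism
  invariants (`FramedRepEquivConj`).
* `satakeFrobCompatibleAt_of_strongLifting_allFinite` — general rank `n`, `E/F` Galois of prime
  degree, CONDITIONAL on the named fact `ArthurClozel1989_strongLifting_allFinite` (Arthur–Clozel
  Ch. 3 Thm. 5.1 with Ch. 1 §6, relation (1.1) at EVERY finite `w ∣ v` with `π_v` unramified): if
  `r` is compatible with `π` at `v` (unramified, `arithFrobPolyOfSatake ι q_v m α`) and `π_v` is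
  unramified, then at every `w ∣ v` the cuspidal weak lift `P` has the Satake parameter
  `α^{f(w|v)}` and `r|_{Γ_E}` is compatible with it.
* `Langlands1980_quadraticBaseChange_frobCompatible_at_of_isUnramifiedAt_under` — **the named
  fact at every finite `w ∤ p` of `F` lying over a prime at which `π` is unramified**, conditional
  on the two named facts above (both unproved in the tree, both XL: the twisted trace formula;
  Shimura varieties / eigenvarieties).  At such `w` the hypothesis "`ρ|_{Γ_F}` unramified at `w`"
  of the fact is not even needed — it is a conclusion.

So, granted lang.S27 and Arthur–Clozel's strong lifting, the CONTENT of the fact is confined to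
the finitely many `w ∤ p` over the primes `ℓ'` RAMIFIED for `π` at which `ρ|_{Γ_F}` is nevertheless
unramified (then `ℓ'` ramifies in `F`, `π_{ℓ'} = π(μ₁, μ₂)` is a ramified principal series with
`μ_i ∘ N_{F_w/ℚ_{ℓ'}}` unramified, and `P_w = π(μ₁ ∘ N, μ₂ ∘ N)`): there the printed proof needs
Carayol's Theorem (A) in Weil–Deligne form (`WD(ρ_π|_{Γ_{ℚ_ℓ'}})^{F-ss} = rec(π_{ℓ'})`, in
particular "`ρ_π|_{Γ_{F_w}}` unramified ⇒ `rec(π_{ℓ'})|_{W_{F_w}}` unramified") and Langlands'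
local lifting of RAMIFIED principal series at every place (Langlands 1980 §2 (i), (A), (F);
Arthur–Clozel Thm. 5.1 beyond unramified `π_v`) — neither is in the tree (see the fact's
docstring and the seat notes); the discharge `Langlands1980_quadraticBaseChange_frobCompatible_holds`
is NOT here.

## References

* R. P. Langlands, *Base Change for GL(2)*, Ann. of Math. Stud. 96 (1980), §2 (pp. 13–14: local
  lifting, (i) and a)–g); pp. 19–20: global lifting, (A)–(F)), §3 Lemma 3.1. [LanglandsBaseChange1980]
* J. Arthur, L. Clozel, *Simple algebras, base change, and the advanced theory of the trace formula*,
  Ann. of Math. Stud. 120 (1989), Ch. 3 §1 (1.1), Def. 1.1–1.2, Thm. 5.1 (pp. 212–214); Ch. 1 §6.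
  [ArthurClozelAMS120]
* H. Carayol, *Sur les représentations ℓ-adiques associées aux formes modulaires de Hilbert*, Ann.
  Sci. ÉNS 19 (1986), Thm. (A) (pp. 410–411), §12.2 (pp. 457–458). [CarayolASENS1986]
* M. Harris, K.-W. Lan, R. Taylor, J. Thorne, *On the rigid cohomology of certain Shimura
  varieties*, Res. Math. Sci. 3 (2016), Thm. A. [HarrisLanTaylorThorneRMS2016]
* K. Buzzard, T. Gee, *The conjectural connections between automorphic representations and Galois
  representations*, LMS Lecture Note Ser. 414 (2014), §2.1, §5.3. [BuzzardGeeLMS2014]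
* P. Deligne, J.-P. Serre, *Formes modulaires de poids 1*, Ann. Sci. ÉNS 7 (1974), Lemme 3.2.
  [DeligneSerreASENS1974]
-/

noncomputable section

open scoped MatrixGroups Matrix NumberField Polynomial Classical
open NumberField IsDedekindDomain Field Polynomial Filter
open Literature.NumberTheory.GaloisRepresentations

namespace Literature.NumberTheory.Automorphic

/-! ## Almost-everywhere Satake–Frobenius compatibility along a weak base change -/

section General

variable {n : ℕ} {K : Type} [Field K] [NumberField K] {L : Type} [Field L] [NumberField L]
  [Algebra K L] {hK : isCompact_glFiniteIntegralLevel n K} {hL : isCompact_glFiniteIntegralLevel n L}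
  {ℓ : ℕ} [Fact ℓ.Prime]

/-- **Satake–Frobenius compatibility restricts along a weak base change, almost everywhere.**
Let `π`, `P` be automorphic representations of `GL_n(𝔸_K)`, `GL_n(𝔸_L)` (`L ⊇ K` number fields)
with `P` a weak base-change lift of `π` (`IsWeakBaseChangeLiftAE`: for almost every `w ∣ v`,
`t_{P,w} = t_{π,v}^{f(w|v)}`; Arthur–Clozel Ch. 3 (1.1), Def. 1.1), and let
`ρ : Γ_K → GL_n(ℚ̄_ℓ)` be, at almost every place `v` of `K`, unramified with arithmetic-Frobenius
characteristic polynomial `arithFrobPolyOfSatake ι q_v m α` for a Satake parameter `α` of `π` at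
`v`.  Then at almost every place `w` of `L`, `P` has a Satake parameter `β` (namely
`t_{π,v}^{f(w|v)}`), `ρ|_{Γ_L}` is unramified at `w`, and its arithmetic Frobenii at `w` have
characteristic polynomial `arithFrobPolyOfSatake ι q_w m β` (`Frob_w = Frob_v^{f(w|v)}` modulo
inertia, `q_w = q_v^{f(w|v)}`: `hasFrobCharpolyAt_restrictField_arithFrobPolyOfSatake`; the finitely
many bad `v` lie below finitely many `w`: `eventually_under`).  Harris–Taylor, proof of Thm.
VII.1.9, p. 230 ("`[R_l(Res Π)] = [R_l(Π)|_{Gal(F^ac/F')}]`"), here with the Satake parameter of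
`P` produced rather than consumed. [cite: ArthurClozelAMS120, Ch. 3 §1 (1.1) and Def. 1.1] -/
theorem eventually_satakeFrobCompatible_restrictField_of_isWeakBaseChangeLiftAE
    (ι : PadicAlgCl ℓ ≃+* ℂ) (m : ℕ) (π : AutomorphicRepData (AutomorphyDatum.gl n K hK))
    (P : AutomorphicRepData (AutomorphyDatum.gl n L hL)) (hBC : IsWeakBaseChangeLiftAE π P)
    (ρ : FramedGaloisRep K (PadicAlgCl ℓ) n)
    (hρ : ∀ᶠ v : HeightOneSpectrum (𝓞 K) in cofinite,
      ∃ α : Multiset ℂ, π.HasSatakeParamAt v α ∧ ρ.IsUnramifiedAt v ∧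
        ρ.HasFrobCharpolyAt v (arithFrobPolyOfSatake ι v.residueCard m α)) :
    ∀ᶠ w : HeightOneSpectrum (𝓞 L) in cofinite,
      ∃ β : Multiset ℂ, P.HasSatakeParamAt w β ∧ (ρ.restrictField L).IsUnramifiedAt w ∧
        (ρ.restrictField L).HasFrobCharpolyAt w (arithFrobPolyOfSatake ι w.residueCard m β) := by
  filter_upwards [hBC, eventually_under (E := L) hρ] with w hw hv
  obtain ⟨α, hα, hur, hch⟩ := hv (w.under (𝓞 K)) rfl
  exact ⟨_, hw (w.under (𝓞 K)) α rfl hα,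
    hasFrobCharpolyAt_restrictField_arithFrobPolyOfSatake (L := L) ι ρ (v := w.under (𝓞 K))
      (w := w) rfl hur m hch⟩

end General

/-! ## The named fact at all but finitely many places -/

section Quadratic

variable {F : Type} [Field F] [NumberField F] {p : ℕ} [Fact p.Prime]
  {hQ : isCompact_glFiniteIntegralLevel 2 ℚ} {hF : isCompact_glFiniteIntegralLevel 2 F}

/-- **`Langlands1980_quadraticBaseChange_frobCompatible` holds at all but finitely many places**
(the part of the named fact that is bookkeeping in the datum model): with `π` on `GL₂(𝔸_ℚ)`,
`ρ : Γ_ℚ → GL₂(ℚ̄_p)` Satake–Frobenius compatible with `π` almost everywhere in Buzzard–Gee's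
L-normalisation (`arithFrobPolyOfSatake ι q 1 α`) and `P` a weak base-change lift of `π` to `F`,
for all but finitely many finite places `w` of `F` the conclusion of the fact holds at `w` — so in
particular for all but finitely many `w ∤ p` at which `ρ|_{Γ_F}` is unramified.  None of the
fact's other hypotheses (quadratic `F`, cuspidality, regular L-algebraic infinity type,
irreducibility of `ρ`) is used; they matter only at the finitely many remaining places, which are
the content of Langlands' strong lifting and Carayol's Theorem (A).
[cite: LanglandsBaseChange1980, §2 (A), (F) (pp. 19–20) with (i) (p. 13)] -/
theorem Langlands1980_quadraticBaseChange_frobCompatible_eventually (ι : PadicAlgCl p ≃+* ℂ)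
    (π : CuspidalAutomorphicRepData 2 ℚ hQ) (ρ : FramedGaloisRep ℚ (PadicAlgCl p) 2)
    (hρ : ∀ᶠ v : HeightOneSpectrum (𝓞 ℚ) in cofinite,
      ∃ α : Multiset ℂ, π.1.HasSatakeParamAt v α ∧ ρ.IsUnramifiedAt v ∧
        ρ.HasFrobCharpolyAt v (arithFrobPolyOfSatake ι v.residueCard 1 α))
    (P : CuspidalAutomorphicRepData 2 F hF) (hBC : IsWeakBaseChangeLiftAE π.1 P.1) :
    ∀ᶠ w : HeightOneSpectrum (𝓞 F) in cofinite,
      (p : 𝓞 F) ∉ w.asIdeal → (ρ.restrictField F).IsUnramifiedAt w →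
        ∃ α : Multiset ℂ, P.1.HasSatakeParamAt w α ∧ (ρ.restrictField F).IsUnramifiedAt w ∧
          (ρ.restrictField F).HasFrobCharpolyAt w
            (arithFrobPolyOfSatake ι w.residueCard 1 α) :=
  (eventually_satakeFrobCompatible_restrictField_of_isWeakBaseChangeLiftAE ι 1 π.1 P.1 hBC ρ
    hρ).mono fun _ h _ _ ↦ h

end Quadratic

/-! ## From almost everywhere to every unramified place off `ℓ` (given lang.S27) -/

section EveryGoodPlace

variable {n : ℕ} {K : Type} [Field K] [NumberField K] {hcpt : isCompact_glFiniteIntegralLevel n K}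
  {ℓ : ℕ} [Fact ℓ.Prime]

/-- The real number `(n-1)/2` cast to `ℂ`. [folklore] -/
private theorem cast_half (n : ℕ) : ((((n : ℝ) - 1) / 2 : ℝ) : ℂ) = ((n : ℂ) - 1) / 2 := by
  push_cast; ring

omit [NumberField K] in
/-- An L-algebraic infinity type stays L-algebraic under the integral twist `|det|^{n-1}`
(Buzzard–Gee 2014, §3.1: integral twists preserve integrality of the exponents). [cite: BuzzardGeeLMS2014, §3.1] -/
private theorem isLAlgebraic_twist_sub_one {T : InfinityType K n} (h : T.IsLAlgebraic) :
    (T.twist ((n : ℂ) - 1)).IsLAlgebraic := by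
  intro σ p hp
  rw [InfinityType.twist_apply, Multiset.mem_map] at hp
  obtain ⟨p₀, hp₀, rfl⟩ := hp
  obtain ⟨k, l, hk, hl⟩ := h σ p₀ hp₀
  exact ⟨k + (n - 1 : ℤ), l + (n - 1 : ℤ), by rw [ArchWeight.twist_a, hk]; push_cast; ring,
    by rw [ArchWeight.twist_b, hl]; push_cast; ring⟩

omit [NumberField K] in
/-- **L-algebraic ⇒ C-algebraic after the half-twist `|det|^{(n-1)/2}`** on infinity types: if
every exponent of `T` is integral, every exponent of `T.twist ((n-1)/2)` lies in `(n-1)/2 + ℤ`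
(Buzzard–Gee 2014, §5.3, the discussion after Def. 5.3.3; the tree's
`InfinityType.isCAlgebraic_iff_isLAlgebraic_twist` composed with the integral twist `|det|^{n-1}`).
[cite: BuzzardGeeLMS2014, §5.3] -/
theorem InfinityType.IsLAlgebraic.isCAlgebraic_twist_half {T : InfinityType K n}
    (h : T.IsLAlgebraic) : (T.twist (((n : ℂ) - 1) / 2)).IsCAlgebraic := by
  rw [InfinityType.isCAlgebraic_iff_isLAlgebraic_twist, InfinityType.twist_twist, add_halves]
  exact isLAlgebraic_twist_sub_one h

/-- **The half-twist arithmetic**: `(√q)^{n-1} · (q^{-(n-1)/2} · a) = a` for a natural `q > 0`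
and `n ≥ 1` (complex power with real exponent). [folklore] -/
private theorem sqrt_pow_mul_cpow_neg_half_mul {q : ℕ} (hq : 0 < q) (hn : 1 ≤ n) (a : ℂ) :
    ((Real.sqrt q : ℝ) : ℂ) ^ (n - 1) * ((q : ℂ) ^ (-((((n : ℝ) - 1) / 2 : ℝ) : ℂ)) * a) = a := by
  have hq0 : (0 : ℝ) ≤ q := Nat.cast_nonneg q
  have hsqrt : ((Real.sqrt q : ℝ) : ℂ) ^ (n - 1) = (q : ℂ) ^ (((((n : ℝ) - 1) / 2 : ℝ)) : ℂ) := by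
    rw [show (q : ℂ) = ((q : ℝ) : ℂ) by norm_cast, ← Complex.ofReal_cpow hq0, ← Complex.ofReal_pow]
    congr 1
    rw [Real.sqrt_eq_rpow, ← Real.rpow_natCast, ← Real.rpow_mul hq0, Nat.cast_sub hn,
      Nat.cast_one]
    congr 1
    ring
  have hqC : (q : ℂ) ≠ 0 := by exact_mod_cast hq.ne'
  have hne : (q : ℂ) ^ (((((n : ℝ) - 1) / 2 : ℝ)) : ℂ) ≠ 0 := fun h ↦
    hqC ((Complex.cpow_eq_zero_iff _ _).mp h).1
  rw [← mul_assoc, hsqrt, Complex.cpow_neg, mul_inv_cancel₀ hne, one_mul]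

/-- **`m = n` on the half-twisted parameter is `m = 1` on the parameter**: for `q > 0`, `n ≥ 1`,
`arithFrobPolyOfSatake ι q n (q^{-(n-1)/2} · α) = arithFrobPolyOfSatake ι q 1 α` — both are
`∏_{a ∈ α} (X - ι⁻¹(a⁻¹))`, since `(√q)^{n-1} q^{-(n-1)/2} = 1`.  This is the passage between
Harris–Lan–Taylor–Thorne's normalisation `rec(π_v ⊗ |det|^{(1-n)/2})` for the regular algebraic
`π ⊗ |det|^{(n-1)/2}` and Buzzard–Gee's L-normalisation for the L-algebraic `π`
(Buzzard–Gee 2014, §2.1 and §5.3). [cite: BuzzardGeeLMS2014, §2.1 and §5.3] -/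
theorem arithFrobPolyOfSatake_map_cpow_neg_half (ι : PadicAlgCl ℓ ≃+* ℂ) {q : ℕ} (hq : 0 < q)
    (hn : 1 ≤ n) (α : Multiset ℂ) :
    arithFrobPolyOfSatake ι q n (α.map (((q : ℂ) ^ (-((((n : ℝ) - 1) / 2 : ℝ) : ℂ))) * ·)) =
      arithFrobPolyOfSatake ι q 1 α := by
  rw [arithFrobPolyOfSatake, arithFrobPolyOfSatake, Multiset.map_map]
  congr 1
  refine Multiset.map_congr rfl fun a _ ↦ ?_
  simp only [Function.comp_apply, Nat.sub_self, pow_zero, one_mul]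
  rw [sqrt_pow_mul_cpow_neg_half_mul hq hn]

/-- The finitely many places above `ℓ` are avoided almost everywhere. [folklore] -/
private theorem eventually_natCast_not_mem_asIdeal' :
    ∀ᶠ v : HeightOneSpectrum (𝓞 K) in cofinite, ((ℓ : ℕ) : 𝓞 K) ∉ v.asIdeal := by
  have hne : Ideal.span {((ℓ : ℕ) : 𝓞 K)} ≠ ⊥ := by
    rw [Ne, Ideal.span_singleton_eq_bot]
    exact_mod_cast (Fact.out : ℓ.Prime).ne_zero
  refine Filter.mem_of_superset (Ideal.finite_factors hne).compl_mem_cofinite ?_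
  intro v hv hmem
  exact hv (Ideal.dvd_span_singleton.2 hmem)

/-- **From almost everywhere to every unramified place off `ℓ`, in the L-normalisation** (granted
lang.S27).  Let `K` be totally real or CM, `π` a cuspidal automorphic representation of
`GL_n(𝔸_K)` (`n ≥ 1`) with a regular L-algebraic infinity type `T`, `ι : ℚ̄_ℓ ≃ ℂ`, and
`ρ : Γ_K → GL_n(ℚ̄_ℓ)` continuous SEMISIMPLE and Satake–Frobenius compatible with `π` at almost
every finite place in Buzzard–Gee's L-normalisation (`ρ` unramified at `v` with arithmetic-Frobenius
characteristic polynomial `arithFrobPolyOfSatake ι q_v 1 α = ∏ (X - ι⁻¹(α_j⁻¹))` for a Satake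
parameter `α` of `π` at `v`).  Assume lang.S27 (`exists_galoisRep_of_regularAlgebraic`:
Harris–Lan–Taylor–Thorne 2016 Thm. A, with compatibility at EVERY unramified `v ∤ ℓ` — Varma 2024
Thm. 1).  Then `ρ` is compatible with `π` at EVERY finite `v ∤ ℓ` at which `π` is unramified: for
every Satake parameter `α` of `π` at `v`, `ρ` is unramified at `v` with arithmetic-Frobenius
characteristic polynomial `arithFrobPolyOfSatake ι q_v 1 α`.  Proof: `π' = π ⊗ |det|^{(n-1)/2}`
is cuspidal regular algebraic (Buzzard–Gee §5.3; `CuspidalAutomorphicRepData.exists_twist_hasInfinityType`,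
`InfinityType.IsLAlgebraic.isCAlgebraic_twist_half`) with Satake parameters `q_v^{-(n-1)/2} t_{π,v}`
(`HasSatakeParamAt.of_map_mulChar_detTwist_of_cpow`), so the semisimple `r = r_{ℓ,ι}(π')` of
lang.S27 satisfies the conclusion (`arithFrobPolyOfSatake_map_cpow_neg_half`); `ρ` and `r` have
the same Frobenius polynomials almost everywhere, hence `r ≅ ρ` (Deligne–Serre 1974, Lemme 3.2:
Chebotarev — the proved `chebotarev_artinRep_holds` — and Brauer–Nesbitt,
`FramedGaloisRep.nonempty_equiv_of_hasFrobCharpolyAt_eventually`), and the conclusion is an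
isomorphism invariant (`FramedGaloisRep.isUnramifiedAt_of_equiv`, `hasFrobCharpolyAt_of_equiv`).
[cite: HarrisLanTaylorThorneRMS2016, Thm. A] [cite: BuzzardGeeLMS2014, §5.3]
[cite: DeligneSerreASENS1974, Lemme 3.2 (p. 513)] -/
theorem hasFrobCharpolyAt_one_of_eventually_of_exists_galoisRep [NeZero n]
    (h27 : exists_galoisRep_of_regularAlgebraic) (hK : IsTotallyReal K ∨ IsCMField K)
    (ι : PadicAlgCl ℓ ≃+* ℂ) (π : CuspidalAutomorphicRepData n K hcpt) {T : InfinityType K n}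
    (hT : π.1.HasInfinityType T) (hTL : T.IsLAlgebraic) (hTR : T.IsRegular)
    (ρ : FramedGaloisRep K (PadicAlgCl ℓ) n) (hρss : ρ.toGaloisRep.IsSemisimple)
    (hρ : ∀ᶠ v : HeightOneSpectrum (𝓞 K) in cofinite,
      ∃ α : Multiset ℂ, π.1.HasSatakeParamAt v α ∧ ρ.IsUnramifiedAt v ∧
        ρ.HasFrobCharpolyAt v (arithFrobPolyOfSatake ι v.residueCard 1 α))
    {v : HeightOneSpectrum (𝓞 K)} (hv : ((ℓ : ℕ) : 𝓞 K) ∉ v.asIdeal) {α : Multiset ℂ}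
    (hα : π.1.HasSatakeParamAt v α) :
    ρ.IsUnramifiedAt v ∧ ρ.HasFrobCharpolyAt v (arithFrobPolyOfSatake ι v.residueCard 1 α) := by
  -- (1) the regular algebraic twist `π' = π ⊗ |det|^{(n-1)/2}`
  obtain ⟨χ, π', hχ, hW, hW', hT'⟩ := π.exists_twist_hasInfinityType (((n : ℝ) - 1) / 2) hT
  have hreg' : π'.1.IsRegularAlgebraic := by
    refine ⟨_, hT', ?_, hTR.twist _⟩
    rw [cast_half]
    exact hTL.isCAlgebraic_twist_half
  -- (2) lang.S27 for `π'`: `r` semisimple, compatible at every unramified `v ∤ ℓ` (`m = n`)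
  obtain ⟨r, hrss, hr⟩ := h27 hcpt hK π' hreg' ℓ ι
  -- (3) read on `π` in the L-normalisation (`m = 1`)
  have key : ∀ (u : HeightOneSpectrum (𝓞 K)) (β : Multiset ℂ), π.1.HasSatakeParamAt u β →
      ((ℓ : ℕ) : 𝓞 K) ∉ u.asIdeal →
        r.IsUnramifiedAt u ∧ r.HasFrobCharpolyAt u (arithFrobPolyOfSatake ι u.residueCard 1 β) := by
    intro u β hβ hu
    have hβ' := AutomorphicRepData.HasSatakeParamAt.of_map_mulChar_detTwist_of_cpow hχ hW hW' hβ
    have h := hr u _ hβ' hu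
    rwa [arithFrobPolyOfSatake_map_cpow_neg_half ι (Nat.zero_lt_of_lt u.one_lt_residueCard)
      NeZero.one_le] at h
  -- (4) `r ≅ ρ`: same Frobenius polynomials almost everywhere, both semisimple
  have hae : ∀ᶠ u : HeightOneSpectrum (𝓞 K) in cofinite,
      r.IsUnramifiedAt u ∧ ρ.IsUnramifiedAt u ∧
        ∃ P : (PadicAlgCl ℓ)[X], r.HasFrobCharpolyAt u P ∧ ρ.HasFrobCharpolyAt u P := by
    filter_upwards [hρ, eventually_natCast_not_mem_asIdeal' (K := K) (ℓ := ℓ)] with u hu huℓ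
    obtain ⟨β, hβ, hρur, hρch⟩ := hu
    obtain ⟨hrur, hrch⟩ := key u β hβ huℓ
    exact ⟨hrur, hρur, _, hrch, hρch⟩
  obtain ⟨e⟩ := FramedGaloisRep.nonempty_equiv_of_hasFrobCharpolyAt_eventually
    chebotarev_artinRep_holds r ρ hrss hρss hae
  -- (5) transport from `r` to `ρ` at `v`
  obtain ⟨hrur, hrch⟩ := key v α hα hv
  exact ⟨FramedGaloisRep.isUnramifiedAt_of_equiv e hrur,
    FramedGaloisRep.hasFrobCharpolyAt_of_equiv e hrch⟩

/-- **Irreducible variant** of `hasFrobCharpolyAt_one_of_eventually_of_exists_galoisRep` (an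
irreducible representation over a field is semisimple). [cite: HarrisLanTaylorThorneRMS2016, Thm. A] -/
theorem hasFrobCharpolyAt_one_of_eventually_of_exists_galoisRep_of_isIrreducible [NeZero n]
    (h27 : exists_galoisRep_of_regularAlgebraic) (hK : IsTotallyReal K ∨ IsCMField K)
    (ι : PadicAlgCl ℓ ≃+* ℂ) (π : CuspidalAutomorphicRepData n K hcpt) {T : InfinityType K n}
    (hT : π.1.HasInfinityType T) (hTL : T.IsLAlgebraic) (hTR : T.IsRegular)
    (ρ : FramedGaloisRep K (PadicAlgCl ℓ) n) (hirr : ρ.toGaloisRep.IsIrreducible)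
    (hρ : ∀ᶠ v : HeightOneSpectrum (𝓞 K) in cofinite,
      ∃ α : Multiset ℂ, π.1.HasSatakeParamAt v α ∧ ρ.IsUnramifiedAt v ∧
        ρ.HasFrobCharpolyAt v (arithFrobPolyOfSatake ι v.residueCard 1 α))
    {v : HeightOneSpectrum (𝓞 K)} (hv : ((ℓ : ℕ) : 𝓞 K) ∉ v.asIdeal) {α : Multiset ℂ}
    (hα : π.1.HasSatakeParamAt v α) :
    ρ.IsUnramifiedAt v ∧ ρ.HasFrobCharpolyAt v (arithFrobPolyOfSatake ι v.residueCard 1 α) := by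
  have hρss : ρ.toGaloisRep.IsSemisimple := by
    haveI : ρ.toGaloisRep.toRepresentation.IsIrreducible := hirr
    change ρ.toGaloisRep.toRepresentation.IsSemisimpleRepresentation
    infer_instance
  exact hasFrobCharpolyAt_one_of_eventually_of_exists_galoisRep h27 hK ι π hT hTL hTR ρ hρss hρ hv hα

end EveryGoodPlace

/-! ## Compatibility at every place above an unramified place of `π`, along a strong lifting -/

section StrongLifting

variable {n : ℕ} {F E : Type} [Field F] [NumberField F] [Field E] [NumberField E] [Algebra F E]
  [IsGalois F E] {hF : isCompact_glFiniteIntegralLevel n F} {hE : isCompact_glFiniteIntegralLevel n E}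
  {ℓ : ℕ} [Fact ℓ.Prime]

/-- **Satake–Frobenius compatibility passes up a cyclic base change of prime degree at EVERY place
above an unramified place of `π`** (granted Arthur–Clozel's strong lifting).  Let `E/F` be Galois
of prime degree, `π`, `P` cuspidal on `GL_n(𝔸_F)`, `GL_n(𝔸_E)` with `P` a weak base-change lift of
`π` (`IsWeakBaseChangeLiftAE`), and assume `ArthurClozel1989_strongLifting_allFinite` (Arthur–Clozel
1989, Ch. 3 Thm. 5.1 "If `Π` is a weak lifting of `π`, then `Π` is in fact a strong lifting", with
Ch. 1 §6: at every finite `w ∣ v` with `π_v` unramified, `t_{P,w} = t_{π,v}^{f(w|v)}` — also at `v`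
ramified in `E`).  If `r : Γ_F → GL_n(ℚ̄_ℓ)` is unramified at `v` with arithmetic-Frobenius
characteristic polynomial `arithFrobPolyOfSatake ι q_v m α` for a Satake parameter `α` of `π` at
`v`, then at every place `w ∣ v` of `E`: `P` has the Satake parameter `β = α^{f(w|v)}`, `r|_{Γ_E}` is
unramified at `w`, and its arithmetic Frobenii at `w` have characteristic polynomial
`arithFrobPolyOfSatake ι q_w m β` (`Frob_w = Frob_v^{f(w|v)}`, `q_w = q_v^{f(w|v)}`:
`hasFrobCharpolyAt_restrictField_arithFrobPolyOfSatake`).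
[cite: ArthurClozelAMS120, Ch. 3 Thm. 5.1 with §1 (1.1) and Def. 1.2; Ch. 1 §6] -/
theorem satakeFrobCompatibleAt_of_strongLifting_allFinite
    (hAC : ArthurClozel1989_strongLifting_allFinite) (hl : (Module.finrank F E).Prime)
    (ι : PadicAlgCl ℓ ≃+* ℂ) (m : ℕ) {π : CuspidalAutomorphicRepData n F hF}
    {P : CuspidalAutomorphicRepData n E hE} (hBC : IsWeakBaseChangeLiftAE π.1 P.1)
    (r : FramedGaloisRep F (PadicAlgCl ℓ) n) {v : HeightOneSpectrum (𝓞 F)}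
    {w : HeightOneSpectrum (𝓞 E)} (hw : w.asIdeal.under (𝓞 F) = v.asIdeal) {α : Multiset ℂ}
    (hα : π.1.HasSatakeParamAt v α) (hur : r.IsUnramifiedAt v)
    (hch : r.HasFrobCharpolyAt v (arithFrobPolyOfSatake ι v.residueCard m α)) :
    ∃ β : Multiset ℂ, P.1.HasSatakeParamAt w β ∧ (r.restrictField E).IsUnramifiedAt w ∧
      (r.restrictField E).HasFrobCharpolyAt w (arithFrobPolyOfSatake ι w.residueCard m β) :=
  ⟨_, hAC n F E hl hF hE π P hBC w v α hw hα,
    hasFrobCharpolyAt_restrictField_arithFrobPolyOfSatake ι r hw hur m hch⟩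

end StrongLifting

/-! ## The named fact at every place above an unramified prime of `π` (given the two facts) -/

section QuadraticGood

variable {F : Type} [Field F] [NumberField F] {p : ℕ} [Fact p.Prime]
  {hQ : isCompact_glFiniteIntegralLevel 2 ℚ} {hF : isCompact_glFiniteIntegralLevel 2 F}

omit [Fact p.Prime] in
/-- `(p) ∤ w` in `𝓞 F` implies `(p) ∤ w ∩ 𝓞 ℚ`. [folklore] -/
private theorem natCast_not_mem_under {w : HeightOneSpectrum (𝓞 F)}
    (hwp : (p : 𝓞 F) ∉ w.asIdeal) : ((p : ℕ) : 𝓞 ℚ) ∉ (w.under (𝓞 ℚ)).asIdeal := by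
  intro h
  apply hwp
  have h' : algebraMap (𝓞 ℚ) (𝓞 F) (p : 𝓞 ℚ) ∈ w.asIdeal := Ideal.mem_comap.mp h
  rwa [map_natCast] at h'

/-- **`Langlands1980_quadraticBaseChange_frobCompatible` at every finite `w ∤ p` of `F` above a prime
at which `π` is unramified**, CONDITIONAL on the named facts lang.S27
(`exists_galoisRep_of_regularAlgebraic`) and `ArthurClozel1989_strongLifting_allFinite`.  With the
fact's data — `F/ℚ` quadratic, `π` cuspidal on `GL₂(𝔸_ℚ)` with a regular L-algebraic infinity
type, `ρ : Γ_ℚ → GL₂(ℚ̄_p)` irreducible and Satake–Frobenius compatible with `π` almost everywhere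
(L-normalisation), `P` a cuspidal weak base-change lift of `π` to `F` — and a finite place `w ∤ p`
of `F` such that `π` is unramified at the prime `w ∩ ℤ`: `P` has a Satake parameter `α` at `w`
(namely `t_{π, w∩ℤ}^{f(w)}`), `ρ|_{Γ_F}` is unramified at `w`, and its arithmetic Frobenii at `w`
have characteristic polynomial `arithFrobPolyOfSatake ι q_w 1 α`.  (`ρ` is compatible with `π` AT
`w ∩ ℤ` by `hasFrobCharpolyAt_one_of_eventually_of_exists_galoisRep_of_isIrreducible`; then
`satakeFrobCompatibleAt_of_strongLifting_allFinite` with `m = 1`; `F/ℚ` quadratic is Galois of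
prime degree.)  The fact's hypothesis "`ρ|_{Γ_F}` unramified at `w`" is not used here; what this
theorem does NOT cover are the finitely many `w ∤ p` above the primes ramified for `π`
(Langlands 1980, §2 (i), (A), (F); Carayol 1986, Thm. (A) and §12.2 — see the module docstring).
[cite: ArthurClozelAMS120, Ch. 3 Thm. 5.1 with §1 (1.1) and Def. 1.2]
[cite: HarrisLanTaylorThorneRMS2016, Thm. A] [cite: LanglandsBaseChange1980, §2 (A), (F) (pp. 19–20)] -/
theorem Langlands1980_quadraticBaseChange_frobCompatible_at_of_isUnramifiedAt_under
    (hAC : ArthurClozel1989_strongLifting_allFinite) (h27 : exists_galoisRep_of_regularAlgebraic)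
    (hF2 : Module.finrank ℚ F = 2) (ι : PadicAlgCl p ≃+* ℂ)
    (π : CuspidalAutomorphicRepData 2 ℚ hQ) {T : InfinityType ℚ 2} (hT : π.1.HasInfinityType T)
    (hTL : T.IsLAlgebraic) (hTR : T.IsRegular) (ρ : FramedGaloisRep ℚ (PadicAlgCl p) 2)
    (hirr : ρ.toGaloisRep.IsIrreducible)
    (hρ : ∀ᶠ v : HeightOneSpectrum (𝓞 ℚ) in cofinite,
      ∃ α : Multiset ℂ, π.1.HasSatakeParamAt v α ∧ ρ.IsUnramifiedAt v ∧
        ρ.HasFrobCharpolyAt v (arithFrobPolyOfSatake ι v.residueCard 1 α))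
    (P : CuspidalAutomorphicRepData 2 F hF) (hBC : IsWeakBaseChangeLiftAE π.1 P.1)
    (w : HeightOneSpectrum (𝓞 F)) (hwp : (p : 𝓞 F) ∉ w.asIdeal)
    (hπ : π.1.IsUnramifiedAt (w.under (𝓞 ℚ))) :
    ∃ α : Multiset ℂ, P.1.HasSatakeParamAt w α ∧ (ρ.restrictField F).IsUnramifiedAt w ∧
      (ρ.restrictField F).HasFrobCharpolyAt w (arithFrobPolyOfSatake ι w.residueCard 1 α) := by
  haveI : Algebra.IsQuadraticExtension ℚ F := ⟨hF2⟩
  haveI : IsGalois ℚ F := inferInstance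
  have hprime : (Module.finrank ℚ F).Prime := hF2 ▸ Nat.prime_two
  obtain ⟨α, hα⟩ := hπ
  obtain ⟨hur, hch⟩ := hasFrobCharpolyAt_one_of_eventually_of_exists_galoisRep_of_isIrreducible
    h27 (Or.inl inferInstance) ι π hT hTL hTR ρ hirr hρ (natCast_not_mem_under hwp) hα
  exact satakeFrobCompatibleAt_of_strongLifting_allFinite hAC hprime ι 1 hBC ρ rfl hα hur hch

/-- **The named fact off the ramified primes of `π`, almost-everywhere hypotheses only at the bad
places** — a restatement of `Langlands1980_quadraticBaseChange_frobCompatible_at_of_isUnramifiedAt_under`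
in the fact's own quantifier shape: granted the two named facts, for every `w ∤ p` at which
`ρ|_{Γ_F}` is unramified AND `π` is unramified below `w`, the conclusion of
`Langlands1980_quadraticBaseChange_frobCompatible` holds at `w`.
[cite: ArthurClozelAMS120, Ch. 3 Thm. 5.1 with §1 (1.1) and Def. 1.2]
[cite: LanglandsBaseChange1980, §2 (A), (F) (pp. 19–20)] -/
theorem Langlands1980_quadraticBaseChange_frobCompatible_of_isUnramifiedAt_under
    (hAC : ArthurClozel1989_strongLifting_allFinite) (h27 : exists_galoisRep_of_regularAlgebraic) :
    ∀ (F : Type) [Field F] [NumberField F], Module.finrank ℚ F = 2 →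
      ∀ (p : ℕ) [Fact p.Prime] (ι : PadicAlgCl p ≃+* ℂ)
        (hQ : isCompact_glFiniteIntegralLevel 2 ℚ) (hF : isCompact_glFiniteIntegralLevel 2 F)
        (π : CuspidalAutomorphicRepData 2 ℚ hQ) (T : InfinityType ℚ 2),
        π.1.HasInfinityType T → T.IsLAlgebraic → T.IsRegular →
      ∀ (ρ : FramedGaloisRep ℚ (PadicAlgCl p) 2), ρ.toGaloisRep.IsIrreducible →
        (∀ᶠ v : HeightOneSpectrum (𝓞 ℚ) in cofinite,
          ∃ α : Multiset ℂ, π.1.HasSatakeParamAt v α ∧ ρ.IsUnramifiedAt v ∧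
            ρ.HasFrobCharpolyAt v (arithFrobPolyOfSatake ι v.residueCard 1 α)) →
      ∀ (P : CuspidalAutomorphicRepData 2 F hF), IsWeakBaseChangeLiftAE π.1 P.1 →
      ∀ w : HeightOneSpectrum (𝓞 F), (p : 𝓞 F) ∉ w.asIdeal → (ρ.restrictField F).IsUnramifiedAt w →
        π.1.IsUnramifiedAt (w.under (𝓞 ℚ)) →
        ∃ α : Multiset ℂ, P.1.HasSatakeParamAt w α ∧ (ρ.restrictField F).IsUnramifiedAt w ∧
          (ρ.restrictField F).HasFrobCharpolyAt w (arithFrobPolyOfSatake ι w.residueCard 1 α) :=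
  fun _F _ _ hF2 _p _ ι _hQ _hF π _T hT hTL hTR ρ hirr hρ P hBC w hwp _ hπ ↦
    Langlands1980_quadraticBaseChange_frobCompatible_at_of_isUnramifiedAt_under hAC h27 hF2 ι π hT
      hTL hTR ρ hirr hρ P hBC w hwp hπ

end QuadraticGood

end Literature.NumberTheory.Automorphic

end
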